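import Literature.NumberTheory.LFunctions.Zhang2022.DetectorDoublingIdentity
import Literature.NumberTheory.LFunctions.Zhang2022.DetectorEntangledBulkFreeEnd

/-!
# Extremal arcs MINIMISE the bulk energy among equal-jet competitors (when the doubly-clamped form is PSD)

Sub-cell E of the `landau-siegel` programme; piece «K8b-min» of the SHARPNESS theorem (ls-barrier-num g3,
HOME/barrier/num/TWO-SIDED-CIRCLE.md §7): the orthogonality of an Euler–Lagrange extremal `E = extremal b γ`
(`DetectorDoublingClamped`) to every doubly-clamped perturbation, and the resulting Pythagoras / minimality statements
for the bulk form `Det.bulkFormOn b 0 1` (K1) with its polar companion `Det.bulkPolarOn` (`DetectorEntangledBulkFreeEnd`).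

* `Det.bulkFormOn_add_eq` — the quadratic expansion `T(S+R) = T(S) + T(R) + 2Re T(S,R)` (continuous data).
* `Det.bulkPolarOn_extremal_eq_zero_of_clamped` — **orthogonality**: for `φ` with `φ(0) = φ(1) = φ′(0) = φ′(1) = 0`
  (`C²` on `[0,1]`), `T_b^([0,1])(φ, E) = 0` — five integrations by parts move every derivative onto `E`, where the
  Euler–Lagrange equation `E⁗ + iπe₁E‴ − π²e₂E″ − iπ³e₃E′ = 0` (`Det.extremal_euler_lagrange`) kills the integrand.
* `Det.bulkFormOn_extremal_add_clamped` — **Pythagoras**: `T(E + φ) = T(E) + T(φ)`.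
* `Det.bulkFormOn_extremal_le_of_clampedNonneg` — **minimality**: if `T(φ) ≥ 0` then `T(E) ≤ T(E + φ)`: an extremal arc
  has the least bulk energy among `C²` competitors with the same four end jets, PROVIDED the doubly-clamped form is
  non-negative at the difference (case (A) of the sharpness dichotomy).

Elementary calculus (tagged by the display whose object is the bulk form); 0 facts, 0 sorries.
«The programme SEARCHES and TYPES; no claim about Landau–Siegel zeros, Theorems 1–2 of arXiv:2211.02515 or a repaired
Margin232 until a kernel theorem says so.» -/

noncomputable section

open Complex Real ComplexConjugate Set MeasureTheory intervalIntegral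

namespace Literature.NumberTheory.LFunctions.Zhang2022

namespace Det

variable (b : Fin 3 → ℝ)

/-! ### Part 1 — the quadratic expansion of the bulk form -/

/-- Pointwise polarisation of the bulk density. [folklore] -/
private theorem density_add (e₁ e₂ e₃ : ℝ) (s s' s'' r r' r'' : ℂ) :
    ‖s'' + r''‖ ^ 2 + π * e₁ * ((s'' + r'') * conj (s' + r')).im + π ^ 2 * e₂ * ‖s' + r'‖ ^ 2
        + π ^ 3 * e₃ * ((s' + r') * conj (s + r)).im
      = (‖s''‖ ^ 2 + π * e₁ * (s'' * conj s').im + π ^ 2 * e₂ * ‖s'‖ ^ 2 + π ^ 3 * e₃ * (s' * conj s).im)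
        + (‖r''‖ ^ 2 + π * e₁ * (r'' * conj r').im + π ^ 2 * e₂ * ‖r'‖ ^ 2 + π ^ 3 * e₃ * (r' * conj r).im)
        + 2 * (s'' * conj r'' + I * ((π * e₁ / 2 : ℝ) : ℂ) * (s' * conj r'' - s'' * conj r')
            + ((π ^ 2 * e₂ : ℝ) : ℂ) * (s' * conj r')
            - I * ((π ^ 3 * e₃ / 2 : ℝ) : ℂ) * (s' * conj r - s * conj r')).re := by
  simp only [Complex.sq_norm, Complex.normSq_apply, Complex.add_re, Complex.add_im, Complex.sub_re, Complex.sub_im,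
    Complex.mul_re, Complex.mul_im, Complex.conj_re, Complex.conj_im, Complex.I_re, Complex.I_im, Complex.ofReal_re,
    Complex.ofReal_im]
  ring

variable {S S' S'' R R' R'' : ℝ → ℂ}

/-- **Quadratic expansion of the bulk form:** `T(S+R) = T(S) + T(R) + 2·Re T(S,R)` on `[0,1]`, for continuous data.
[cite: Zhang2022LandauSiegel, Prop 7.1 p.44 with (8.11)–(8.23)] -/
theorem bulkFormOn_add_eq (hS : ContinuousOn S (Icc 0 1)) (hS' : ContinuousOn S' (Icc 0 1))
    (hS'' : ContinuousOn S'' (Icc 0 1)) (hR : ContinuousOn R (Icc 0 1)) (hR' : ContinuousOn R' (Icc 0 1))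
    (hR'' : ContinuousOn R'' (Icc 0 1)) :
    bulkFormOn b 0 1 (fun y => S y + R y) (fun y => S' y + R' y) (fun y => S'' y + R'' y)
      = bulkFormOn b 0 1 S S' S'' + bulkFormOn b 0 1 R R' R''
        + 2 * (bulkPolarOn b 0 1 S S' S'' R R' R'').re := by
  unfold bulkFormOn bulkPolarOn
  have hI : ∀ {f : ℝ → ℂ}, ContinuousOn f (Icc 0 1) → IntervalIntegrable f volume 0 1 := fun hf =>
    hf.intervalIntegrable_of_Icc zero_le_one
  have hcS := hI hS; have hcS' := hI hS'; have hcS'' := hI hS''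
  have hcR := hI hR; have hcR' := hI hR'; have hcR'' := hI hR''
  -- integrability of the three real densities and of the polar integrand
  have iS : IntervalIntegrable (fun y => ‖S'' y‖ ^ 2 + π * (b 0 + b 1 + b 2) * (S'' y * conj (S' y)).im
      + π ^ 2 * (b 0 * b 1 + b 1 * b 2 + b 2 * b 0) * ‖S' y‖ ^ 2
      + π ^ 3 * (b 0 * b 1 * b 2) * (S' y * conj (S y)).im) volume 0 1 := by
    apply ContinuousOn.intervalIntegrable_of_Icc zero_le_one
    have := hS''; have := hS'; have := hS
    fun_prop
  have iR : IntervalIntegrable (fun y => ‖R'' y‖ ^ 2 + π * (b 0 + b 1 + b 2) * (R'' y * conj (R' y)).im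
      + π ^ 2 * (b 0 * b 1 + b 1 * b 2 + b 2 * b 0) * ‖R' y‖ ^ 2
      + π ^ 3 * (b 0 * b 1 * b 2) * (R' y * conj (R y)).im) volume 0 1 := by
    apply ContinuousOn.intervalIntegrable_of_Icc zero_le_one
    fun_prop
  have iPc : ContinuousOn (fun y => S'' y * conj (R'' y)
      + I * ((π * (b 0 + b 1 + b 2) / 2 : ℝ) : ℂ) * (S' y * conj (R'' y) - S'' y * conj (R' y))
      + ((π ^ 2 * (b 0 * b 1 + b 1 * b 2 + b 2 * b 0) : ℝ) : ℂ) * (S' y * conj (R' y))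
      - I * ((π ^ 3 * (b 0 * b 1 * b 2) / 2 : ℝ) : ℂ) * (S' y * conj (R y) - S y * conj (R' y))) (Icc 0 1) := by
    fun_prop
  have iP := hI iPc
  have iPre : IntervalIntegrable (fun y => 2 * (S'' y * conj (R'' y)
      + I * ((π * (b 0 + b 1 + b 2) / 2 : ℝ) : ℂ) * (S' y * conj (R'' y) - S'' y * conj (R' y))
      + ((π ^ 2 * (b 0 * b 1 + b 1 * b 2 + b 2 * b 0) : ℝ) : ℂ) * (S' y * conj (R' y))
      - I * ((π ^ 3 * (b 0 * b 1 * b 2) / 2 : ℝ) : ℂ) * (S' y * conj (R y) - S y * conj (R' y))).re) volume 0 1 := by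
    apply ContinuousOn.intervalIntegrable_of_Icc zero_le_one
    exact (continuous_const.continuousOn.mul (Complex.continuous_re.comp_continuousOn iPc))
  rw [intervalIntegral.integral_congr (fun y _ => density_add (b 0 + b 1 + b 2)
      (b 0 * b 1 + b 1 * b 2 + b 2 * b 0) (b 0 * b 1 * b 2) (S y) (S' y) (S'' y) (R y) (R' y) (R'' y)),
    intervalIntegral.integral_add (iS.add iR) iPre, intervalIntegral.integral_add iS iR,
    intervalIntegral.integral_const_mul]
  congr 1
  have := Complex.reCLM.intervalIntegral_comp_comm iP
  simpa only [Complex.reCLM_apply] using congrArg (fun z : ℝ => 2 * z) this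

/-! ### Part 2 — orthogonality of an extremal to every doubly-clamped perturbation -/

section Orthogonal

variable (γ : Fin 4 → ℂ) {φ φ' φ'' : ℝ → ℂ}

/-- The POLAR jet bracket `Λ = φ′·conj E″ − (iπe₁/2)φ′·conj E′ + φ·(−conj E‴ + iπe₁·conj E″ + π²e₂·conj E′ − (iπ³e₃/2)conj E)`
whose derivative is the polar bulk density of `(φ, E)` once the Euler–Lagrange equation of `E` is used.
[cite: Zhang2022LandauSiegel, §7 Prop. 7.1 p.44; §2 (2.32)–(2.33)] -/
def polarBracket (b : Fin 3 → ℝ) (γ : Fin 4 → ℂ) (φ φ' : ℝ → ℂ) (t : ℝ) : ℂ :=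
  φ' t * conj (extremalDD b γ t) - I * ((π * (b 0 + b 1 + b 2) / 2 : ℝ) : ℂ) * (φ' t * conj (extremalD b γ t))
    + φ t * (-conj (extremalDDD b γ t) + I * ((π * (b 0 + b 1 + b 2) : ℝ) : ℂ) * conj (extremalDD b γ t)
        + ((π ^ 2 * (b 0 * b 1 + b 1 * b 2 + b 2 * b 0) : ℝ) : ℂ) * conj (extremalD b γ t)
        - I * ((π ^ 3 * (b 0 * b 1 * b 2) / 2 : ℝ) : ℂ) * conj (extremal b γ t))

/-- `conj ∘ E^{(k)}` is differentiable with derivative `conj ∘ E^{(k+1)}`. [folklore] -/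
private theorem hasDerivAt_conj_comp {f : ℝ → ℂ} {f' : ℂ} {t : ℝ} (h : HasDerivAt f f' t) :
    HasDerivAt (fun s => conj (f s)) (conj f') t := by
  have := h.star
  simpa only [starRingEnd_apply] using this

/-- **The polar bracket differentiates to the polar density** (at points where `φ, φ′` are differentiable).
[cite: Zhang2022LandauSiegel, §7 Prop. 7.1 p.44] -/
theorem hasDerivAt_polarBracket {t : ℝ} (hφ : HasDerivAt φ (φ' t) t) (hφ' : HasDerivAt φ' (φ'' t) t) :
    HasDerivAt (polarBracket b γ φ φ')
      (φ'' t * conj (extremalDD b γ t)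
        + I * ((π * (b 0 + b 1 + b 2) / 2 : ℝ) : ℂ) * (φ' t * conj (extremalDD b γ t) - φ'' t * conj (extremalD b γ t))
        + ((π ^ 2 * (b 0 * b 1 + b 1 * b 2 + b 2 * b 0) : ℝ) : ℂ) * (φ' t * conj (extremalD b γ t))
        - I * ((π ^ 3 * (b 0 * b 1 * b 2) / 2 : ℝ) : ℂ) * (φ' t * conj (extremal b γ t) - φ t * conj (extremalD b γ t))) t := by
  have e0 := hasDerivAt_conj_comp (hasDerivAt_extremal b γ t)
  have e1 := hasDerivAt_conj_comp (hasDerivAt_extremalD b γ t)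
  have e2 := hasDerivAt_conj_comp (hasDerivAt_extremalDD b γ t)
  have e3 := hasDerivAt_conj_comp (hasDerivAt_extremalDDD b γ t)
  have hEL := congrArg conj (extremal_euler_lagrange b γ t)
  simp only [map_add, map_sub, map_mul, map_zero, map_pow, Complex.conj_I, Complex.conj_ofReal] at hEL
  push_cast at hEL
  have hΛ := ((hφ'.mul e2).sub ((hφ'.mul e1).const_mul (I * ((π * (b 0 + b 1 + b 2) / 2 : ℝ) : ℂ)))).add
    (hφ.mul ((((e3.neg).add (e2.const_mul (I * ((π * (b 0 + b 1 + b 2) : ℝ) : ℂ)))).add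
      (e1.const_mul (((π ^ 2 * (b 0 * b 1 + b 1 * b 2 + b 2 * b 0) : ℝ) : ℂ)))).sub
      (e0.const_mul (I * ((π ^ 3 * (b 0 * b 1 * b 2) / 2 : ℝ) : ℂ)))))
  have hfun : polarBracket b γ φ φ' = fun s =>
      (φ' s * conj (extremalDD b γ s) - I * ((π * (b 0 + b 1 + b 2) / 2 : ℝ) : ℂ) * (φ' s * conj (extremalD b γ s)))
      + φ s * (-conj (extremalDDD b γ s) + I * ((π * (b 0 + b 1 + b 2) : ℝ) : ℂ) * conj (extremalDD b γ s)
          + ((π ^ 2 * (b 0 * b 1 + b 1 * b 2 + b 2 * b 0) : ℝ) : ℂ) * conj (extremalD b γ s)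
          - I * ((π ^ 3 * (b 0 * b 1 * b 2) / 2 : ℝ) : ℂ) * conj (extremal b γ s)) := by
    funext s; unfold polarBracket; ring
  rw [hfun]
  refine hΛ.congr_deriv ?_
  simp only [Pi.add_apply, Pi.sub_apply, Pi.neg_apply]
  push_cast
  linear_combination (-(φ t)) * hEL

/-- **ORTHOGONALITY.** For a `C²` perturbation `φ` on `[0,1]` with all four end jets zero and any extremal `E = extremal b γ`:
`T_b^([0,1])(φ, E) = 0`. [cite: Zhang2022LandauSiegel, §7 Prop. 7.1 p.44; §2 (2.32)–(2.33)] -/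
theorem bulkPolarOn_extremal_eq_zero_of_clamped (hφ : ∀ t ∈ uIcc (0:ℝ) 1, HasDerivAt φ (φ' t) t)
    (hφ' : ∀ t ∈ uIcc (0:ℝ) 1, HasDerivAt φ' (φ'' t) t) (hφ''c : ContinuousOn φ'' (Icc 0 1))
    (h0 : φ 0 = 0) (h1 : φ 1 = 0) (h0' : φ' 0 = 0) (h1' : φ' 1 = 0) :
    bulkPolarOn b 0 1 φ φ' φ'' (extremal b γ) (extremalD b γ) (extremalDD b γ) = 0 := by
  unfold bulkPolarOn
  have hφc : ContinuousOn φ (Icc 0 1) := fun t ht =>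
    (hφ t (by rwa [uIcc_of_le zero_le_one])).continuousAt.continuousWithinAt
  have hφ'c : ContinuousOn φ' (Icc 0 1) := fun t ht =>
    (hφ' t (by rwa [uIcc_of_le zero_le_one])).continuousAt.continuousWithinAt
  have cE := (continuous_extremal b γ).continuousOn (s := Icc (0:ℝ) 1)
  have cE1 := (continuous_extremalD b γ).continuousOn (s := Icc (0:ℝ) 1)
  have cE2 := (continuous_extremalDD b γ).continuousOn (s := Icc (0:ℝ) 1)
  have hint : IntervalIntegrable (fun y => φ'' y * conj (extremalDD b γ y)
      + I * ((π * (b 0 + b 1 + b 2) / 2 : ℝ) : ℂ) * (φ' y * conj (extremalDD b γ y) - φ'' y * conj (extremalD b γ y))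
      + ((π ^ 2 * (b 0 * b 1 + b 1 * b 2 + b 2 * b 0) : ℝ) : ℂ) * (φ' y * conj (extremalD b γ y))
      - I * ((π ^ 3 * (b 0 * b 1 * b 2) / 2 : ℝ) : ℂ) * (φ' y * conj (extremal b γ y) - φ y * conj (extremalD b γ y)))
      volume 0 1 := by
    apply ContinuousOn.intervalIntegrable_of_Icc zero_le_one
    fun_prop
  rw [intervalIntegral.integral_eq_sub_of_hasDerivAt (fun t ht => hasDerivAt_polarBracket b γ (hφ t ht) (hφ' t ht))
    hint]
  unfold polarBracket
  rw [h0, h1, h0', h1']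
  ring

/-! ### Part 3 — Pythagoras and minimality -/

/-- **Pythagoras for an extremal and a clamped perturbation:** `T(E + φ) = T(E) + T(φ)`.
[cite: Zhang2022LandauSiegel, §7 Prop. 7.1 p.44; §2 (2.32)–(2.33)] -/
theorem bulkFormOn_extremal_add_clamped (hφ : ∀ t ∈ uIcc (0:ℝ) 1, HasDerivAt φ (φ' t) t)
    (hφ' : ∀ t ∈ uIcc (0:ℝ) 1, HasDerivAt φ' (φ'' t) t) (hφ''c : ContinuousOn φ'' (Icc 0 1))
    (h0 : φ 0 = 0) (h1 : φ 1 = 0) (h0' : φ' 0 = 0) (h1' : φ' 1 = 0) :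
    bulkFormOn b 0 1 (fun y => extremal b γ y + φ y) (fun y => extremalD b γ y + φ' y)
        (fun y => extremalDD b γ y + φ'' y)
      = bulkFormOn b 0 1 (extremal b γ) (extremalD b γ) (extremalDD b γ) + bulkFormOn b 0 1 φ φ' φ'' := by
  have hφc : ContinuousOn φ (Icc 0 1) := fun t ht =>
    (hφ t (by rwa [uIcc_of_le zero_le_one])).continuousAt.continuousWithinAt
  have hφ'c : ContinuousOn φ' (Icc 0 1) := fun t ht =>
    (hφ' t (by rwa [uIcc_of_le zero_le_one])).continuousAt.continuousWithinAt
  rw [bulkFormOn_add_eq b (continuous_extremal b γ).continuousOn (continuous_extremalD b γ).continuousOn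
    (continuous_extremalDD b γ).continuousOn hφc hφ'c hφ''c]
  have hP : bulkPolarOn b 0 1 (extremal b γ) (extremalD b γ) (extremalDD b γ) φ φ' φ'' = 0 := by
    rw [← conj_bulkPolarOn, bulkPolarOn_extremal_eq_zero_of_clamped b γ hφ hφ' hφ''c h0 h1 h0' h1', map_zero]
  rw [hP, Complex.zero_re, mul_zero, add_zero]

/-- **MINIMALITY (case (A) of the sharpness dichotomy):** if the doubly-clamped perturbation has `T(φ) ≥ 0`, the extremal
arc has no more bulk energy than the competitor `E + φ` with the same four end jets.
[cite: Zhang2022LandauSiegel, §7 Prop. 7.1 p.44; §2 (2.32)–(2.33)] -/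
theorem bulkFormOn_extremal_le_of_clampedNonneg (hφ : ∀ t ∈ uIcc (0:ℝ) 1, HasDerivAt φ (φ' t) t)
    (hφ' : ∀ t ∈ uIcc (0:ℝ) 1, HasDerivAt φ' (φ'' t) t) (hφ''c : ContinuousOn φ'' (Icc 0 1))
    (h0 : φ 0 = 0) (h1 : φ 1 = 0) (h0' : φ' 0 = 0) (h1' : φ' 1 = 0) (hQ : 0 ≤ bulkFormOn b 0 1 φ φ' φ'') :
    bulkFormOn b 0 1 (extremal b γ) (extremalD b γ) (extremalDD b γ)
      ≤ bulkFormOn b 0 1 (fun y => extremal b γ y + φ y) (fun y => extremalD b γ y + φ' y)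
          (fun y => extremalDD b γ y + φ'' y) := by
  rw [bulkFormOn_extremal_add_clamped b γ hφ hφ' hφ''c h0 h1 h0' h1']
  linarith

end Orthogonal

end Det

end Literature.NumberTheory.LFunctions.Zhang2022
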